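import Summits.QuantumFields.YangMills.Theorems.FemtoCutoffLadderSmallFieldSplitGlueRepaired
import Summits.QuantumFields.YangMills.Theorems.FemtoCutoffLadderLargeFieldInsensitivityTopPos

/-!
# Route `FemtoCutoffLadder` — reductions of the repaired large-field crux `LargeFieldInsensitivityR` (stmt-QuantumFields-26197)
# and its by-name glue into `OctaveStepDecay` (stmt-QuantumFields-24153)

Lead seat `ym-line-fcl-p1` g9 (2026-08-28).  Route rev 17 (planner ym-idea-1 g5) restated the misstated child `LargeFieldInsensitivity`
(25696, aside) as `LargeFieldInsensitivityR` (26197): for every `κ ∈ (0,1)` and `σ > 0`, clause 1 `0 < t_κ` and the two comparisons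
`λ₁^L t_κ^L ≤ e^{CΛ²/L^σ + A/β²} s_κ^L λ₀^L`, `s_κ^L λ₀^L ≤ e^{CΛ²/L^σ + A/β²} λ₁^L t_κ^L` (`t_κ`, `s_κ` the SF_κ-compressed top / second
min–max values).  This file records what a prover of 26197 may drop:
* ★ `largeFieldInsensitivityR_of_comparisons` — clause 1 is free (`SFCompression.smallFieldTop_pos`, p607603): the TWO COMPARISONS alone
  give the item BY NAME;
* ★ `largeFieldInsensitivityR_of_betaAllowance` — the `L`-decaying term is idle on the proving side: the comparisons with the pure
  `β`-allowance `e^{A/β²}` (`A ≥ 0`; NO `CΛ²/L^σ` term, `σ`-free) give the item for every `σ` (take `C = 0`).  This is the honest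
  target: the large-field effect is `L`-uniform and `β`-small (per-plaquette weight `e^{−cβ^κ}`; toron sensitivity of a one-plaquette tail
  event is a winding effect), never a power of `1/L` along the window (`β` is only logarithmic in `L` there, `WindowCoupling.beta_le_of_window`);
* ★ `octaveStepDecay_of_smallField_of_largeFieldInsensitivityR : SmallFieldOctaveStep → LargeFieldInsensitivityR → OctaveStepDecay` —
  the live decomposition of 24153 BY NAME (the lead-g8 glue `octaveStepDecay_of_smallField_of_largeFieldR`, p606919, whose second
  hypothesis is the body of the new decl verbatim).
HONEST FRAMING: bookkeeping; 26197 and 25695 are OPEN two-cutoff statements behind `UVStabilityNonUniqueness`.  R2b1 is a RECORD rung —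
not infinite volume, not a mass gap, not Clay; no summit is proved by this line.  No definitions, no named facts, no `sorry`.
-/

set_option autoImplicit false

noncomputable section

namespace Summit.QuantumFields.YangMills.Theorems.FemtoCutoffLadder

open Literature.MathematicalPhysics.QuantumFieldTheory hiding SU2
open Summit.QuantumFields.YangMills.Theorems.FemtoTransferGap
open Summit.QuantumFields.YangMills.Theses.FemtoCutoffLadder

/-- ★ **Clause 1 is free**: the two comparison clauses of `LargeFieldInsensitivityR` (spelled out, same constants) give the item BY NAME,
clause 1 `0 < t_κ` being `SFCompression.smallFieldTop_pos` at every `β > 0`. [folklore] -/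
theorem largeFieldInsensitivityR_of_comparisons
    (h : ∀ κ σ : ℝ, 0 < κ → κ < 1 → 0 < σ → ∃ (C A lam0 : ℝ) (L0 : ℕ), 0 ≤ C ∧ 0 ≤ A ∧ 0 < lam0 ∧
      ∀ lam : ℝ, 0 < lam → lam ≤ lam0 → ∀ (L : ℕ) [NeZero L], L0 ≤ L → ∀ β : ℝ, InFemtoWindow lam β L →
        let P : (GaugeConfig 3 L SU2 → ℝ) → Prop := fun ψ => ∀ U,
          (∃ p : Plaquette 3 L, β ^ (κ - 1) < 2 - (su2Rep (plaquetteHolonomy U p.1 p.2.1.1 p.2.1.2)).trace.re) → ψ U = 0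
        secondValue su2Rep L β ^ L * sSup (rayleighSet su2Rep L β P) ^ L ≤
          Real.exp (C * luscherLambda β L ^ 2 / (L : ℝ) ^ σ + A / β ^ 2) *
            (sInf {x : ℝ | ∃ φ : GaugeConfig 3 L SU2 → ℝ, IsPhys φ ∧
              x = sSup (rayleighSet su2Rep L β fun ψ => P ψ ∧ l2 ψ φ = 0)} ^ L * topValue su2Rep L β ^ L) ∧
        sInf {x : ℝ | ∃ φ : GaugeConfig 3 L SU2 → ℝ, IsPhys φ ∧
            x = sSup (rayleighSet su2Rep L β fun ψ => P ψ ∧ l2 ψ φ = 0)} ^ L * topValue su2Rep L β ^ L ≤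
          Real.exp (C * luscherLambda β L ^ 2 / (L : ℝ) ^ σ + A / β ^ 2) *
            (secondValue su2Rep L β ^ L * sSup (rayleighSet su2Rep L β P) ^ L)) :
    LargeFieldInsensitivityR := by
  intro κ σ hκ hκ1 hσ
  obtain ⟨C, A, lam0, L0, hC, hA, hlam0, H⟩ := h κ σ hκ hκ1 hσ
  refine ⟨C, A, lam0, L0, hC, hA, hlam0, fun lam hlam hle L _ hL0 β hW => ?_⟩
  have hβ : 0 < β := by linarith [hW.1]
  exact ⟨SFCompression.smallFieldTop_pos L hβ κ, H lam hlam hle L hL0 β hW⟩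

/-- ★ **The `L`-decaying term is idle; the honest target is a pure `β`-allowance.**  If for every `κ ∈ (0,1)` there are `A ≥ 0`,
`lam0 > 0`, `L0` with the two SF_κ-compressed comparisons at slack `e^{A/β²}` on every window lattice `L ≥ L0`, then
`LargeFieldInsensitivityR` holds (for every `σ`, with `C = 0`). [folklore] -/
theorem largeFieldInsensitivityR_of_betaAllowance
    (h : ∀ κ : ℝ, 0 < κ → κ < 1 → ∃ (A lam0 : ℝ) (L0 : ℕ), 0 ≤ A ∧ 0 < lam0 ∧
      ∀ lam : ℝ, 0 < lam → lam ≤ lam0 → ∀ (L : ℕ) [NeZero L], L0 ≤ L → ∀ β : ℝ, InFemtoWindow lam β L →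
        let P : (GaugeConfig 3 L SU2 → ℝ) → Prop := fun ψ => ∀ U,
          (∃ p : Plaquette 3 L, β ^ (κ - 1) < 2 - (su2Rep (plaquetteHolonomy U p.1 p.2.1.1 p.2.1.2)).trace.re) → ψ U = 0
        secondValue su2Rep L β ^ L * sSup (rayleighSet su2Rep L β P) ^ L ≤
          Real.exp (A / β ^ 2) *
            (sInf {x : ℝ | ∃ φ : GaugeConfig 3 L SU2 → ℝ, IsPhys φ ∧
              x = sSup (rayleighSet su2Rep L β fun ψ => P ψ ∧ l2 ψ φ = 0)} ^ L * topValue su2Rep L β ^ L) ∧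
        sInf {x : ℝ | ∃ φ : GaugeConfig 3 L SU2 → ℝ, IsPhys φ ∧
            x = sSup (rayleighSet su2Rep L β fun ψ => P ψ ∧ l2 ψ φ = 0)} ^ L * topValue su2Rep L β ^ L ≤
          Real.exp (A / β ^ 2) * (secondValue su2Rep L β ^ L * sSup (rayleighSet su2Rep L β P) ^ L)) :
    LargeFieldInsensitivityR := by
  apply largeFieldInsensitivityR_of_comparisons
  intro κ σ hκ hκ1 _hσ
  obtain ⟨A, lam0, L0, hA, hlam0, H⟩ := h κ hκ hκ1
  refine ⟨0, A, lam0, L0, le_rfl, hA, hlam0, fun lam hlam hle L _ hL0 β hW => ?_⟩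
  have h0 : (0 : ℝ) * luscherLambda β L ^ 2 / (L : ℝ) ^ σ + A / β ^ 2 = A / β ^ 2 := by ring
  rw [h0]
  exact H lam hlam hle L hL0 β hW

/-- ★ **The live decomposition of `OctaveStepDecay` (24153) BY NAME**: `SmallFieldOctaveStep` (25695) and `LargeFieldInsensitivityR`
(26197) give `OctaveStepDecay` — the lead-g8 repaired glue (p606919), whose second hypothesis is the body of the route decl verbatim
(output `C = C₁ + 2C₂`, `σ`, `D = D₁ + 3A/(2b₀ log 2)`, tower base `L₀ˢ·2^{L₀ᴸ}`). [folklore] -/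
theorem octaveStepDecay_of_smallField_of_largeFieldInsensitivityR (hA : SmallFieldOctaveStep) (hB : LargeFieldInsensitivityR) :
    OctaveStepDecay :=
  octaveStepDecay_of_smallField_of_largeFieldR hA hB

end Summit.QuantumFields.YangMills.Theorems.FemtoCutoffLadder

end
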